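import Literature.NumberTheory.EllipticCurves.BhargavaShankarLocalWeightProofs
import Literature.Algebra.Module.LocalGlobalLattice
import HarnessLib

/-!
# Bhargava–Shankar, Prop. 3.6: `m(f) = ∏_p m_p(f)` — `PGL₂` has class number one

Topic `Literature/NumberTheory/EllipticCurves`; sequel to `BinaryQuarticOrbitWeights.lean` (the
weights `m(f) = globalWeight f`, `m_p(f) = localWeightAt p f` of M. Bhargava, A. Shankar, *Binary
quartic forms having bounded invariants, and the boundedness of the average rank of elliptic
curves*, Ann. of Math. (2) 181 (2015) 191–242, §3.2 of the published version, and their description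
as numbers of cosets: `m(f) = #(PGL₂(ℤ) \ {g ∈ PGL₂(ℚ) : g · f ∈ V_ℤ})`,
`m_p(f) = #(PGL₂(ℤ_p) \ {g ∈ PGL₂(ℚ_p) : g · f ∈ V_{ℤ_p}})`) and
`BhargavaShankarLocalWeightProofs.lean` (finiteness of the local coset sets, `m_p(f) = 1` for
almost all `p`), with the local–global input `Literature.Algebra.Module.exists_rat_matrix_mem_integral_coset`
("`GL₂` has class number one over `ℚ`", `LocalGlobalLattice.lean`).

Source: Prop. 3.6 of the published version (= `arXiv:1006.1002v3`; not in the held v2 text):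
**"Suppose `f ∈ V_ℤ` has nonzero discriminant. Then `m(f) = ∏_p m_p(f)`."** Its proof there is the
class-number-one property of `PGL₂` ("[the proof] follows from the fact that `G` has class number
one over `ℚ`; the proof is identical to that of [BS, Prop. 3.6]" — A. Shankar, X. Wang,
arXiv:1307.3531, proof of Prop. 4.16, for the analogous weights of a general pair
`G(ℤ) ⊂ G(ℚ)`). This file proves it in the following form. Write `Γ = ℚˣGL₂(ℤ) ≤ GL₂(ℚ)`,
`Γ_p = ℚ_pˣGL₂(ℤ_p) ≤ GL₂(ℚ_p)`, `C(f) = Γ \ {g : g·f ∈ V_ℤ}`, `C_p(f) = Γ_p \ {g : g·f ∈ V_{ℤ_p}}`.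

* **Localisation** `g ↦ (g)_p`: `GL₂(ℚ) → GL₂(ℚ_p)` carries `Γ` into `Γ_p` and `C(f)` into `C_p(f)`
  (`map_mem_integralUpToScalars`, `inv_map_smul_mem_integralForms`), and `(g)_p ∈ GL₂(ℤ_p)` for
  all but finitely many `p` (`exists_finset_forall_exists_eq_map`).
* **Injectivity** (`mem_integralUpToScalars_of_forall`, `coe_eq_coe_of_forall`): an element of
  `GL₂(ℚ)` lying in `ℚ_pˣGL₂(ℤ_p)` for every `p` lies in `ℚˣGL₂(ℤ)` — the scalar is recovered as
  the rational `∏ p^{v_p}` with `v_p` the valuation of the local scalars.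
* **Surjectivity** (`exists_global_of_local`): local cosets `g_pΓ_p ∈ C_p(f)`, trivial outside a
  finite set, come from one global `gΓ ∈ C(f)` — class number one of `GL₂` plus "a rational form
  integral at every `p` is integral" (`mem_integralForms_of_forall`).
* Hence (`localize`, `localize_injective`, `exists_localize_eq`) **`C(f) → ∏'_p C_p(f)` is a
  bijection onto the restricted product** (families trivial for almost all `p`), and
  (`globalWeight_eq_finprod_localWeightAt`) **Prop. 3.6: for `f ∈ V_ℤ` with `Δ(f) ≠ 0`,
  `m(f) = ∏_p m_p(f)`**, a finite product by `finite_setOf_localWeightAt_ne_one`; in particular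
  `C(f)` is finite and `m(f) = #C(f) ≥ 1` (`cosets_int_finite_and_ncard_eq`,
  `globalWeight_eq_ncard_cosets`, `one_le_globalWeight_of_disc_ne_zero`).

## References

* M. Bhargava, A. Shankar, Ann. of Math. (2) 181 (2015) 191–242, §3.2 and Prop. 3.6 of the published
  version (= arXiv:1006.1002v3). [cite: BhargavaShankarAnnals2015, Prop. 3.6 (published numbering)]
* A. Shankar, X. Wang, Compos. Math. 154 (2018) = arXiv:1307.3531, Prop. 4.16 and its proof.
* V. Platonov, A. Rapinchuk, *Algebraic groups and number theory* (1994), Ch. 8 (class number of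
  `GL_n`, `PGL_n` over `ℚ`). [folklore]

## Design

Three small definitions organise the statement of the bijection: `LocalCosets f p` (the type of
`C_p(f)`, `p : Nat.Primes`), its trivial element `LocalCosets.base f p`, and
`localize f : C(f) → ∀ p, LocalCosets f p`. Everything else is
theorems; primes are quantified as `(p : ℕ) [Fact p.Prime]` as in `LocalGlobalLattice.lean`.
-/

noncomputable section

open scoped Classical
open Matrix MulAction Literature.GroupTheory.Index

namespace Literature.NumberTheory.EllipticCurves

namespace BinaryQuartic

/-! ## The twisted action and change of field -/

/-- The twisted action commutes with field homomorphisms: `(γ·f)^τ = γ^τ · f^τ`. [folklore] -/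
theorem twist_map_map {K L : Type*} [Field K] [Field L] (τ : K →+* L) (γ : Matrix (Fin 2) (Fin 2) K)
    (f : BinaryQuartic K) : twist (γ.map τ) (f.map τ) = (twist γ f).map τ := by
  rw [twist, twist, ← map_subst]
  have hdet : (γ.map τ).det = τ γ.det := by rw [← RingHom.mapMatrix_apply, ← RingHom.map_det]
  rw [hdet, ← map_pow, ← map_inv₀]
  ext <;> simp [map]

section Padic

variable {p : ℕ} [Fact p.Prime]


/-- The matrix of `(g)_p`. [folklore] -/
theorem coe_ιQ (g : GL (Fin 2) ℚ) :
    ((Matrix.GeneralLinearGroup.map (Rat.castHom ℚ_[p]) g : GL (Fin 2) ℚ_[p]) : Matrix (Fin 2) (Fin 2) ℚ_[p]) = (g : Matrix (Fin 2) (Fin 2) ℚ).map (Rat.castHom ℚ_[p]) := rfl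


/-- Localisation is compatible with the actions: `(g · F)^(Rat.castHom ℚ_[p]) = (g)_p · F^(Rat.castHom ℚ_[p])`. [folklore] -/
theorem map_gl_smul (g : GL (Fin 2) ℚ) (F : BinaryQuartic ℚ) : (g • F).map (Rat.castHom ℚ_[p]) = Matrix.GeneralLinearGroup.map (Rat.castHom ℚ_[p]) g • F.map (Rat.castHom ℚ_[p]) := by
  rw [gl_smul_def, gl_smul_def, coe_ιQ, twist_map_map]

/-- The two ways `V_ℤ → V_{ℚ_p}` agree. [folklore] -/
theorem map_ratCast_map_intCast (f : BinaryQuartic ℤ) :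
    (f.map (Int.castRingHom ℚ)).map (Rat.castHom ℚ_[p]) = (f.map (Int.castRingHom ℤ_[p])).map PadicInt.Coe.ringHom := by
  ext <;> simp [map]

/-- **`Γ` localises into `Γ_p`**: `ℚˣGL₂(ℤ) → ℚ_pˣGL₂(ℤ_p)`. [folklore] -/
theorem map_mem_integralUpToScalars {g : GL (Fin 2) ℚ} (hg : g ∈ integralUpToScalars (Int.castRingHom ℚ)) : Matrix.GeneralLinearGroup.map (Rat.castHom ℚ_[p]) g ∈ integralUpToScalars (PadicInt.Coe.ringHom (p := p)) := by
  obtain ⟨c, k, hc, hk, hgk⟩ := hg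
  refine ⟨(Rat.castHom ℚ_[p]) c, k.map (Int.castRingHom ℤ_[p]), (map_ne_zero (Rat.castHom ℚ_[p])).mpr hc, ?_, ?_⟩
  · rw [← RingHom.mapMatrix_apply, ← RingHom.map_det]; exact hk.map _
  · rw [coe_ιQ, hgk]
    ext i j
    simp [Matrix.map_apply]

/-- Integral forms localise to integral forms. [folklore] -/
theorem map_mem_integralForms_padic {F : BinaryQuartic ℚ} (hF : F ∈ integralForms (Int.castRingHom ℚ)) :
    F.map (Rat.castHom ℚ_[p]) ∈ integralForms PadicInt.Coe.ringHom := by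
  obtain ⟨f₀, rfl⟩ := hF
  exact ⟨f₀.map (Int.castRingHom ℤ_[p]), (map_ratCast_map_intCast f₀).symm⟩

/-- `C(f)` localises into `C_p(f)`: if `h⁻¹ · F ∈ V_ℤ` then `(h)_p⁻¹ · F^(Rat.castHom ℚ_[p]) ∈ V_{ℤ_p}`. [folklore] -/
theorem inv_map_smul_mem_integralForms {F : BinaryQuartic ℚ} {h : GL (Fin 2) ℚ}
    (hh : h⁻¹ • F ∈ integralForms (Int.castRingHom ℚ)) : (Matrix.GeneralLinearGroup.map (Rat.castHom ℚ_[p]) h)⁻¹ • F.map (Rat.castHom ℚ_[p]) ∈ integralForms PadicInt.Coe.ringHom := by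
  rw [← map_inv, ← map_gl_smul]
  exact map_mem_integralForms_padic hh

/-! ## Rational numbers, integers and matrices that are integral at every prime -/

omit [Fact p.Prime] in
/-- A rational number lying in `ℤ_p` for every `p` is an integer. [folklore] -/
theorem rat_exists_int_of_forall_exists_padicInt (x : ℚ)
    (h : ∀ (p : ℕ) [Fact p.Prime], ∃ y : ℤ_[p], (y : ℚ_[p]) = x) : ∃ n : ℤ, (n : ℚ) = x := by
  refine Literature.Algebra.Module.Rat.exists_int_eq_of_forall_padicNorm_le_one x fun p hp ↦ ?_
  haveI : Fact p.Prime := ⟨hp⟩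
  obtain ⟨y, hy⟩ := h p
  have : ‖(x : ℚ_[p])‖ ≤ 1 := by rw [← hy, PadicInt.padic_norm_e_of_padicInt]; exact PadicInt.norm_le_one y
  rw [Padic.eq_padicNorm] at this
  exact_mod_cast this

omit [Fact p.Prime] in
/-- An integer of `p`-adic norm `1` for every prime `p` is a unit. [folklore] -/
theorem int_isUnit_of_forall_padicNorm_eq_one (n : ℤ) (h : ∀ p : ℕ, p.Prime → padicNorm p n = 1) :
    IsUnit n := by
  rw [Int.isUnit_iff_natAbs_eq]
  by_contra hne
  have hn0 : n ≠ 0 := by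
    rintro rfl
    have := h 2 Nat.prime_two
    simp [padicNorm.zero] at this
  obtain ⟨q, hq, hqn⟩ := Nat.exists_prime_and_dvd hne
  haveI : Fact q.Prime := ⟨hq⟩
  have hlt : padicNorm q n < 1 := (padicNorm.int_lt_one_iff (p := q) n).mpr (Int.natCast_dvd.mpr hqn)
  exact hlt.ne (h q hq)

omit [Fact p.Prime] in
/-- **A rational form integral at every prime is integral**: `F ∈ V_ℤ` iff `F^(Rat.castHom ℚ_[p]) ∈ V_{ℤ_p}` for all
`p`. [folklore] -/
theorem mem_integralForms_of_forall {F : BinaryQuartic ℚ}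
    (h : ∀ (p : ℕ) [Fact p.Prime], F.map (Rat.castHom ℚ_[p]) ∈ integralForms (PadicInt.Coe.ringHom (p := p))) :
    F ∈ integralForms (Int.castRingHom ℚ) := by
  have key : ∀ x : ℚ, (∀ (p : ℕ) [Fact p.Prime], ∃ f₀ : BinaryQuartic ℤ_[p],
      f₀.map PadicInt.Coe.ringHom = F.map (Rat.castHom ℚ_[p]) ∧ ∃ y ∈ ({f₀.a, f₀.b, f₀.c, f₀.d, f₀.e} : Set ℤ_[p]),
        (y : ℚ_[p]) = x) → ∃ n : ℤ, (n : ℚ) = x := fun x hx ↦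
    rat_exists_int_of_forall_exists_padicInt x fun p _ ↦ by
      obtain ⟨f₀, -, y, -, hy⟩ := hx p
      exact ⟨y, hy⟩
  have hcoef : ∀ (p : ℕ) [Fact p.Prime], ∃ f₀ : BinaryQuartic ℤ_[p],
      f₀.map PadicInt.Coe.ringHom = F.map (Rat.castHom ℚ_[p]) := fun p _ ↦ h p
  obtain ⟨na, ha⟩ := key F.a fun p _ ↦ by
    obtain ⟨f₀, hf₀⟩ := hcoef p
    exact ⟨f₀, hf₀, f₀.a, by simp, by simpa [map] using congrArg BinaryQuartic.a hf₀⟩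
  obtain ⟨nb, hb⟩ := key F.b fun p _ ↦ by
    obtain ⟨f₀, hf₀⟩ := hcoef p
    exact ⟨f₀, hf₀, f₀.b, by simp, by simpa [map] using congrArg BinaryQuartic.b hf₀⟩
  obtain ⟨nc, hc⟩ := key F.c fun p _ ↦ by
    obtain ⟨f₀, hf₀⟩ := hcoef p
    exact ⟨f₀, hf₀, f₀.c, by simp, by simpa [map] using congrArg BinaryQuartic.c hf₀⟩
  obtain ⟨nd, hd⟩ := key F.d fun p _ ↦ by
    obtain ⟨f₀, hf₀⟩ := hcoef p
    exact ⟨f₀, hf₀, f₀.d, by simp, by simpa [map] using congrArg BinaryQuartic.d hf₀⟩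
  obtain ⟨ne, he⟩ := key F.e fun p _ ↦ by
    obtain ⟨f₀, hf₀⟩ := hcoef p
    exact ⟨f₀, hf₀, f₀.e, by simp, by simpa [map] using congrArg BinaryQuartic.e hf₀⟩
  exact ⟨⟨na, nb, nc, nd, ne⟩, by ext <;> simp [map, ha, hb, hc, hd, he]⟩

/-- A nonzero rational has `p`-adic norm `1` at the primes not dividing its numerator and
denominator. [folklore] -/
theorem norm_ratCast_eq_one {x : ℚ} (hnum : ¬ (p : ℤ) ∣ x.num) (hden : ¬ p ∣ x.den) : ‖(x : ℚ_[p])‖ = 1 := by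
  have hn : ‖(x.num : ℚ_[p])‖ = 1 :=
    le_antisymm (Padic.norm_int_le_one _) (not_lt.mp (mt Padic.norm_intCast_lt_one_iff.mp hnum))
  have hd : ‖(x.den : ℚ_[p])‖ = 1 :=
    Padic.norm_natCast_eq_one_iff.mpr ((Nat.Prime.coprime_iff_not_dvd Fact.out).mpr hden)
  conv_lhs => rw [← Rat.num_div_den x]
  rw [Rat.cast_div, Rat.cast_intCast, Rat.cast_natCast, norm_div, hn, hd, div_one]

omit [Fact p.Prime] in
/-- **Localisation of `GL₂(ℚ)` lands in `GL₂(ℤ_p)` for almost all `p`**: outside a finite set of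
primes, `(g)_p = Matrix.GeneralLinearGroup.map PadicInt.Coe.ringHom k` for some `k ∈ GL₂(ℤ_p)`. [folklore] -/
theorem exists_finset_forall_exists_eq_map (g : GL (Fin 2) ℚ) :
    ∃ T : Finset ℕ, ∀ (p : ℕ) [Fact p.Prime], p ∉ T →
      ∃ k : GL (Fin 2) ℤ_[p], Matrix.GeneralLinearGroup.map (n := Fin 2) PadicInt.Coe.ringHom k =
        Matrix.GeneralLinearGroup.map (n := Fin 2) (Rat.castHom ℚ_[p]) g := by
  set D : ℚ := (g : Matrix (Fin 2) (Fin 2) ℚ).det with hDdef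
  have hD : D ≠ 0 := Matrix.GeneralLinearGroup.det_ne_zero g
  set N : ℕ := (∏ i : Fin 2, ∏ j : Fin 2, ((g : Matrix (Fin 2) (Fin 2) ℚ) i j).den) * D.num.natAbs * D.den with hN
  have hNpos : N ≠ 0 := by
    refine Nat.mul_ne_zero (Nat.mul_ne_zero ?_ ?_) (Rat.den_ne_zero D)
    · exact Finset.prod_ne_zero_iff.mpr fun i _ ↦ Finset.prod_ne_zero_iff.mpr fun j _ ↦ Rat.den_ne_zero _
    · exact Int.natAbs_ne_zero.mpr (Rat.num_ne_zero.mpr hD)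
  refine ⟨N.primeFactors, fun p _ hp ↦ ?_⟩
  have hpN : ¬ p ∣ N := fun h ↦ hp (Nat.mem_primeFactors.mpr ⟨Fact.out, h, hNpos⟩)
  have hden : ∀ i j, ¬ p ∣ ((g : Matrix (Fin 2) (Fin 2) ℚ) i j).den := fun i j h ↦ hpN <| h.trans <|
    dvd_mul_of_dvd_left (dvd_mul_of_dvd_left
      ((Finset.dvd_prod_of_mem (fun j ↦ ((g : Matrix (Fin 2) (Fin 2) ℚ) i j).den) (Finset.mem_univ j)).trans
        (Finset.dvd_prod_of_mem (fun i ↦ ∏ j : Fin 2, ((g : Matrix (Fin 2) (Fin 2) ℚ) i j).den)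
          (Finset.mem_univ i))) _) _
  have hnum : ¬ (p : ℤ) ∣ D.num := fun h ↦ hpN <|
    dvd_mul_of_dvd_left (dvd_mul_of_dvd_right (Int.natCast_dvd.mp h) _) _
  have hDden : ¬ p ∣ D.den := fun h ↦ hpN (dvd_mul_of_dvd_right h _)
  -- entries are `p`-integral
  have hint : ∀ i j, ‖((g : Matrix (Fin 2) (Fin 2) ℚ).map (Rat.castHom ℚ_[p])) i j‖ ≤ 1 := fun i j ↦ by
    rw [Matrix.map_apply]
    exact Padic.norm_rat_le_one (hden i j)
  obtain ⟨k₀, hk₀⟩ := Literature.Algebra.Module.exists_map_eq_of_norm_le hint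
  -- determinant is a unit
  have hdet : IsUnit k₀.det := by
    rw [PadicInt.isUnit_iff, ← PadicInt.padic_norm_e_of_padicInt]
    have : (k₀.det : ℚ_[p]) = (D : ℚ_[p]) := by
      change PadicInt.Coe.ringHom k₀.det = Rat.castHom ℚ_[p] D
      rw [RingHom.map_det, RingHom.mapMatrix_apply, hk₀, hDdef, RingHom.map_det, RingHom.mapMatrix_apply]
    rw [this]
    exact norm_ratCast_eq_one hnum hDden
  refine ⟨((Matrix.isUnit_iff_isUnit_det k₀).mpr hdet).unit, Units.ext ?_⟩
  rw [coe_mapGL, coe_ιQ, IsUnit.unit_spec, hk₀]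

/-- The `q`-adic norm of `∏_{p ∈ T} p^{v_p}`: `q^{-v_q}` if `q ∈ T`, and `1` otherwise. [folklore] -/
theorem norm_prod_prime_zpow {T : Finset ℕ} (hT : ∀ q ∈ T, q.Prime) (v : ℕ → ℤ) :
    ‖((∏ q ∈ T, (q : ℚ) ^ v q : ℚ) : ℚ_[p])‖ = if p ∈ T then ((p : ℝ) ^ v p)⁻¹ else 1 := by
  rw [Rat.cast_prod, norm_prod]
  simp only [Rat.cast_zpow, Rat.cast_natCast, norm_zpow]
  have h1 : ∀ q ∈ T, ‖(q : ℚ_[p])‖ ^ v q = if p = q then ((p : ℝ) ^ v p)⁻¹ else 1 := fun q hq ↦ by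
    split_ifs with hpq
    · subst hpq
      rw [Padic.norm_p, _root_.inv_zpow]
    · have : ‖(q : ℚ_[p])‖ = 1 :=
        Padic.norm_natCast_eq_one_iff.mpr ((Nat.coprime_primes Fact.out (hT q hq)).mpr hpq)
      rw [this, _root_.one_zpow]
  rw [Finset.prod_congr rfl h1, Finset.prod_ite_eq]

omit [Fact p.Prime] in
/-- **An element of `GL₂(ℚ)` lying in `ℚ_pˣ·GL₂(ℤ_p)` for every `p` lies in `ℚˣ·GL₂(ℤ)`**
(`PGL₂(ℚ) ∩ ∏_p PGL₂(ℤ_p) = PGL₂(ℤ)`). [folklore] -/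
theorem mem_integralUpToScalars_of_forall (g : GL (Fin 2) ℚ)
    (h : ∀ (p : ℕ) [Fact p.Prime], Matrix.GeneralLinearGroup.map (n := Fin 2) (Rat.castHom ℚ_[p]) g ∈
      integralUpToScalars (PadicInt.Coe.ringHom (p := p))) :
    g ∈ integralUpToScalars (Int.castRingHom ℚ) := by
  have h' : ∀ (p : ℕ) (hp : Fact p.Prime), ∃ (c : ℚ_[p]) (k : Matrix (Fin 2) (Fin 2) ℤ_[p]), c ≠ 0 ∧ IsUnit k.det ∧
      ((g : Matrix (Fin 2) (Fin 2) ℚ).map (Rat.castHom ℚ_[p])) = c • k.map PadicInt.Coe.ringHom :=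
    fun p hp ↦ @h p hp
  choose c k hc hk hgk using h'
  set D : ℚ := (g : Matrix (Fin 2) (Fin 2) ℚ).det with hDdef
  have hD : D ≠ 0 := Matrix.GeneralLinearGroup.det_ne_zero g
  -- `‖c_p‖² = ‖D‖_p`
  have hnormc : ∀ (p : ℕ) (hp : Fact p.Prime), ‖c p hp‖ ^ 2 = ‖(D : ℚ_[p])‖ := fun p hp ↦ by
    have h1 : (D : ℚ_[p]) = (Rat.castHom ℚ_[p]) D := rfl
    rw [h1, hDdef, RingHom.map_det, RingHom.mapMatrix_apply, hgk p hp, Matrix.det_smul, Fintype.card_fin,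
      norm_mul, norm_pow, ← RingHom.mapMatrix_apply, ← RingHom.map_det]
    have : ‖(PadicInt.Coe.ringHom (k p hp).det : ℚ_[p])‖ = 1 := by
      rw [show (PadicInt.Coe.ringHom (k p hp).det : ℚ_[p]) = ((k p hp).det : ℚ_[p]) from rfl,
        PadicInt.padic_norm_e_of_padicInt]
      exact PadicInt.isUnit_iff.mp (hk p hp)
    rw [this, mul_one]
  -- valuations
  let v : ℕ → ℤ := fun p ↦ if hp : p.Prime then @Padic.valuation p ⟨hp⟩ (c p ⟨hp⟩) else 0
  have hcv : ∀ (p : ℕ) (hp : Fact p.Prime), ‖c p hp‖ = ((p : ℝ) ^ v p)⁻¹ := fun p hp ↦ by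
    rw [Padic.norm_eq_zpow_neg_valuation (hc p hp), _root_.zpow_neg]
    simp only [v, dif_pos hp.out]
  -- the finite set of primes where `D` is not a unit
  set N : ℕ := D.num.natAbs * D.den with hN
  have hNpos : N ≠ 0 := Nat.mul_ne_zero (Int.natAbs_ne_zero.mpr (Rat.num_ne_zero.mpr hD)) (Rat.den_ne_zero D)
  set T := N.primeFactors with hT
  have hTprime : ∀ q ∈ T, q.Prime := fun q hq ↦ Nat.prime_of_mem_primeFactors hq
  have hv0 : ∀ (p : ℕ) (hp : Fact p.Prime), p ∉ T → v p = 0 := fun p hp hpT ↦ by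
    have hpN : ¬ p ∣ N := fun hd ↦ hpT (Nat.mem_primeFactors.mpr ⟨hp.out, hd, hNpos⟩)
    have hnum : ¬ (p : ℤ) ∣ D.num := fun hd ↦ hpN (dvd_mul_of_dvd_left (Int.natCast_dvd.mp hd) _)
    have hden : ¬ p ∣ D.den := fun hd ↦ hpN (dvd_mul_of_dvd_right hd _)
    have h1 : ‖c p hp‖ ^ 2 = 1 := by rw [hnormc p hp, norm_ratCast_eq_one hnum hden]
    have h2 : ‖c p hp‖ = 1 := by
      have := (pow_eq_one_iff_of_nonneg (norm_nonneg _) two_ne_zero).mp h1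
      exact this
    rw [hcv p hp] at h2
    have hp1 : (1 : ℝ) < p := by exact_mod_cast hp.out.one_lt
    have h3 : (p : ℝ) ^ v p = (p : ℝ) ^ (0 : ℤ) := by
      rw [zpow_zero]; exact inv_eq_one.mp h2
    exact zpow_right_injective₀ (by linarith) hp1.ne' h3
  -- the global scalar
  set e : ℚ := ∏ q ∈ T, (q : ℚ) ^ v q with he
  have he0 : e ≠ 0 := Finset.prod_ne_zero_iff.mpr fun q hq ↦ zpow_ne_zero _ (Nat.cast_ne_zero.mpr (hTprime q hq).ne_zero)
  have hnorme : ∀ (p : ℕ) (hp : Fact p.Prime), ‖(e : ℚ_[p])‖ = ‖c p hp‖ := fun p hp ↦ by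
    rw [he, norm_prod_prime_zpow hTprime v, hcv p hp]
    split_ifs with hpT
    · rfl
    · rw [hv0 p hp hpT, zpow_zero, inv_one]
  -- the candidate integral matrix `A = e⁻¹ g`, locally `A = (e⁻¹ c_p) k_p` with `e⁻¹ c_p ∈ ℤ_pˣ`
  set A : Matrix (Fin 2) (Fin 2) ℚ := e⁻¹ • (g : Matrix (Fin 2) (Fin 2) ℚ) with hA
  have hloc : ∀ (p : ℕ) (hp : Fact p.Prime), ∃ (u : ℤ_[p]), IsUnit u ∧
      A.map (Rat.castHom ℚ_[p]) = (u • k p hp).map PadicInt.Coe.ringHom := fun p hp ↦ by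
    have hw1 : ‖(e : ℚ_[p])⁻¹ * c p hp‖ = 1 := by
      rw [norm_mul, norm_inv, hnorme p hp, inv_mul_cancel₀]
      exact (norm_pos_iff.mpr (hc p hp)).ne'
    refine ⟨⟨(e : ℚ_[p])⁻¹ * c p hp, hw1.le⟩, PadicInt.isUnit_iff.mpr hw1, ?_⟩
    have hAmap : A.map (Rat.castHom ℚ_[p]) = (e : ℚ_[p])⁻¹ • ((g : Matrix (Fin 2) (Fin 2) ℚ).map (Rat.castHom ℚ_[p])) := by
      rw [hA]; ext i j; simp [Matrix.map_apply]
    rw [hAmap, hgk p hp, smul_smul]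
    ext i j
    simp [Matrix.map_apply]
  -- so `A` is an integer matrix
  have hentry : ∀ i j, ∃ n : ℤ, (n : ℚ) = A i j := fun i j ↦
    rat_exists_int_of_forall_exists_padicInt _ fun p hp ↦ by
      obtain ⟨u, -, hu⟩ := hloc p hp
      refine ⟨(u • k p hp) i j, ?_⟩
      have := congrFun (congrFun hu i) j
      simp only [Matrix.map_apply] at this
      exact this.symm
  choose B hB using hentry
  have hAB : A = (Matrix.of B).map (Int.castRingHom ℚ) := by
    ext i j; simp [hB i j]
  -- with unit determinant
  have hdetB : IsUnit (Matrix.of B).det := by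
    apply int_isUnit_of_forall_padicNorm_eq_one
    intro q hq
    haveI : Fact q.Prime := ⟨hq⟩
    obtain ⟨u, hu, hAu⟩ := hloc q ⟨hq⟩
    have h1 : (((Matrix.of B).det : ℚ) : ℚ_[q]) = ((u • k q ⟨hq⟩).det : ℚ_[q]) := by
      have h2 : ((Matrix.of B).det : ℚ) = A.det := by
        rw [hAB, ← RingHom.mapMatrix_apply, ← RingHom.map_det, eq_intCast]
      rw [h2]
      change (Rat.castHom ℚ_[q]) A.det = PadicInt.Coe.ringHom (u • k q ⟨hq⟩).det
      rw [RingHom.map_det, RingHom.mapMatrix_apply, hAu, RingHom.map_det, RingHom.mapMatrix_apply]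
    have h3 : ‖(((Matrix.of B).det : ℚ) : ℚ_[q])‖ = 1 := by
      rw [h1, PadicInt.padic_norm_e_of_padicInt, ← PadicInt.isUnit_iff, Matrix.det_smul, Fintype.card_fin]
      exact (hu.pow 2).mul (hk q ⟨hq⟩)
    rw [Padic.eq_padicNorm] at h3
    exact_mod_cast h3
  refine ⟨e, Matrix.of B, he0, hdetB, ?_⟩
  rw [← hAB, hA, smul_smul, mul_inv_cancel₀ he0, one_smul]

/-! ## Cosets: injectivity, surjectivity, finiteness of support -/

/-- **Injectivity** of `C(f) → ∏_p C_p(f)`: cosets of `ℚˣGL₂(ℤ)` with the same image in every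
`GL₂(ℚ_p) ⧸ ℚ_pˣGL₂(ℤ_p)` coincide. [cite: BhargavaShankarAnnals2015, Prop. 3.6, proof (published numbering)] -/
theorem coe_eq_coe_of_forall {h h' : GL (Fin 2) ℚ}
    (hloc : ∀ (p : ℕ) [Fact p.Prime], ((Matrix.GeneralLinearGroup.map (n := Fin 2) (Rat.castHom ℚ_[p]) h :
      GL (Fin 2) ℚ_[p]) : GL (Fin 2) ℚ_[p] ⧸ integralUpToScalars (PadicInt.Coe.ringHom (p := p))) =
      ((Matrix.GeneralLinearGroup.map (n := Fin 2) (Rat.castHom ℚ_[p]) h' : GL (Fin 2) ℚ_[p]) :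
        GL (Fin 2) ℚ_[p] ⧸ integralUpToScalars (PadicInt.Coe.ringHom (p := p)))) :
    (h : GL (Fin 2) ℚ ⧸ integralUpToScalars (Int.castRingHom ℚ)) = h' := by
  rw [QuotientGroup.eq]
  refine mem_integralUpToScalars_of_forall _ fun p _ ↦ ?_
  rw [map_mul, map_inv]
  exact QuotientGroup.eq.mp (hloc p)

omit [Fact p.Prime] in
/-- The image of a global coset is the trivial local coset for almost all `p`. [folklore] -/
theorem exists_finset_forall_coe_map_eq_one (h : GL (Fin 2) ℚ) :
    ∃ T : Finset ℕ, ∀ (p : ℕ) [Fact p.Prime], p ∉ T →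
      ((Matrix.GeneralLinearGroup.map (n := Fin 2) (Rat.castHom ℚ_[p]) h : GL (Fin 2) ℚ_[p]) :
        GL (Fin 2) ℚ_[p] ⧸ integralUpToScalars (PadicInt.Coe.ringHom (p := p))) =
        ((1 : GL (Fin 2) ℚ_[p]) : GL (Fin 2) ℚ_[p] ⧸ integralUpToScalars (PadicInt.Coe.ringHom (p := p))) := by
  obtain ⟨T, hT⟩ := exists_finset_forall_exists_eq_map h
  refine ⟨T, fun p _ hp ↦ ?_⟩
  obtain ⟨k, hk⟩ := hT p hp
  rw [QuotientGroup.eq, mul_one, ← hk]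
  exact (integralUpToScalars _).inv_mem (mapGL_mem k)

omit [Fact p.Prime] in
/-- **Surjectivity** (class number one): local elements `g_p ∈ GL₂(ℚ_p)` with `g_p⁻¹ · F ∈ V_{ℤ_p}`
for all `p` and `g_p = 1` outside a finite set come, up to `ℚ_pˣGL₂(ℤ_p)`, from one `g ∈ GL₂(ℚ)` with
`g⁻¹ · F ∈ V_ℤ`. [cite: BhargavaShankarAnnals2015, Prop. 3.6, proof (published numbering)] -/
theorem exists_global_of_local (F : BinaryQuartic ℚ) (T : Finset ℕ)
    (loc : ∀ (p : ℕ) [Fact p.Prime], GL (Fin 2) ℚ_[p])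
    (hloc : ∀ (p : ℕ) [Fact p.Prime], (loc p)⁻¹ • F.map (Rat.castHom ℚ_[p]) ∈
      integralForms (PadicInt.Coe.ringHom (p := p)))
    (hout : ∀ (p : ℕ) [Fact p.Prime], p ∉ T → loc p = 1) :
    ∃ h : GL (Fin 2) ℚ, h⁻¹ • F ∈ integralForms (Int.castRingHom ℚ) ∧ ∀ (p : ℕ) [Fact p.Prime],
      ((Matrix.GeneralLinearGroup.map (n := Fin 2) (Rat.castHom ℚ_[p]) h : GL (Fin 2) ℚ_[p]) :
        GL (Fin 2) ℚ_[p] ⧸ integralUpToScalars (PadicInt.Coe.ringHom (p := p))) =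
        ((loc p : GL (Fin 2) ℚ_[p]) : GL (Fin 2) ℚ_[p] ⧸ integralUpToScalars (PadicInt.Coe.ringHom (p := p))) := by
  set T' := T.filter Nat.Prime with hT'
  have hT'prime : ∀ q ∈ T', q.Prime := fun q hq ↦ (Finset.mem_filter.mp hq).2
  obtain ⟨γ, hγ, hU⟩ := Literature.Algebra.Module.exists_rat_matrix_mem_integral_coset T' hT'prime
    (fun p _ ↦ (((loc p)⁻¹ : GL (Fin 2) ℚ_[p]) : Matrix (Fin 2) (Fin 2) ℚ_[p]))
    (fun p _ ↦ Matrix.isUnits_det_units _)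
    (fun p inst hp ↦ ⟨1, by simp, by
      have : p ∉ T := fun h ↦ hp (Finset.mem_filter.mpr ⟨h, inst.out⟩)
      rw [hout p this, inv_one, Units.val_one, Matrix.map_one _ (map_zero _) (map_one _)]⟩)
  set γGL : GL (Fin 2) ℚ := Matrix.GeneralLinearGroup.mkOfDetNeZero γ hγ with hγGL
  -- local description of `γ`
  have hdesc : ∀ (p : ℕ) [Fact p.Prime], ∃ u : GL (Fin 2) ℤ_[p],
      Matrix.GeneralLinearGroup.map (n := Fin 2) (Rat.castHom ℚ_[p]) γGL =
        Matrix.GeneralLinearGroup.map (n := Fin 2) PadicInt.Coe.ringHom u * (loc p)⁻¹ := fun p _ ↦ by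
    obtain ⟨U, hUu, hγU⟩ := hU p
    refine ⟨((Matrix.isUnit_iff_isUnit_det U).mpr hUu).unit, Units.ext ?_⟩
    rw [Units.val_mul, coe_ιQ, coe_mapGL, IsUnit.unit_spec, ← hγU]
    rfl
  refine ⟨γGL⁻¹, mem_integralForms_of_forall fun p _ ↦ ?_, fun p _ ↦ ?_⟩
  · obtain ⟨u, hu⟩ := hdesc p
    rw [map_gl_smul, inv_inv, hu, mul_smul]
    exact smul_mem_integralForms _ (mapGL_mem u) (hloc p)
  · obtain ⟨u, hu⟩ := hdesc p
    rw [map_inv, hu, _root_.mul_inv_rev, inv_inv, ← map_inv]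
    exact QuotientGroup.mk_mul_of_mem _ (mapGL_mem u⁻¹)

end Padic

/-! ## The restricted product and Prop. 3.6 -/

/-- `C_p(f)` as a type: the cosets `ℚ_pˣGL₂(ℤ_p)·g`, `g ∈ GL₂(ℚ_p)`, with `g · f ∈ V_{ℤ_p}`, for an
integral form `f ∈ V_ℤ` and `p : Nat.Primes`. [cite: BhargavaShankarAnnals2015, §3.2 (B_p(f), m_p(f); published numbering)] -/
abbrev LocalCosets (f : BinaryQuartic ℤ) (p : Nat.Primes) : Type :=
  haveI : Fact (p : ℕ).Prime := ⟨p.2⟩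
  ↥(cosets (PadicInt.Coe.ringHom (p := p)) ((f.map (Int.castRingHom ℤ_[p])).map PadicInt.Coe.ringHom))

/-- The trivial local coset `ℚ_pˣGL₂(ℤ_p) · 1 ∈ C_p(f)` (`f` is integral). [folklore] -/
theorem one_mem_cosets_padic (f : BinaryQuartic ℤ) (p : ℕ) [Fact p.Prime] :
    ((1 : GL (Fin 2) ℚ_[p]) : GL (Fin 2) ℚ_[p] ⧸ integralUpToScalars (PadicInt.Coe.ringHom (p := p))) ∈
      cosets (PadicInt.Coe.ringHom (p := p)) ((f.map (Int.castRingHom ℤ_[p])).map PadicInt.Coe.ringHom) := by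
  rw [coe_mem_cosets_iff, inv_one, one_smul]
  exact map_mem_integralForms _ _

/-- The trivial element of `C_p(f)`. [folklore] -/
def LocalCosets.base (f : BinaryQuartic ℤ) (p : Nat.Primes) : LocalCosets f p :=
  haveI : Fact (p : ℕ).Prime := ⟨p.2⟩
  ⟨_, one_mem_cosets_padic f p⟩

/-- **Localisation of cosets** `C(f) → ∏_p C_p(f)`, `ℚˣGL₂(ℤ)·g ↦ (ℚ_pˣGL₂(ℤ_p)·(g)_p)_p` (in the
`g⁻¹`-encoding of `cosetsOver`: the left coset of `h` goes to the left cosets of `(h)_p`).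
[cite: BhargavaShankarAnnals2015, Prop. 3.6, proof (published numbering)] -/
def localize (f : BinaryQuartic ℤ)
    (q : cosets (Int.castRingHom ℚ) (f.map (Int.castRingHom ℚ))) (p : Nat.Primes) : LocalCosets f p :=
  haveI : Fact (p : ℕ).Prime := ⟨p.2⟩
  ⟨Quotient.map' (Matrix.GeneralLinearGroup.map (n := Fin 2) (Rat.castHom ℚ_[p]))
      (fun a b hab ↦ by
        rw [QuotientGroup.leftRel_apply] at hab ⊢
        rw [← map_inv, ← map_mul]
        exact map_mem_integralUpToScalars hab) q.1, by
    obtain ⟨q, hq⟩ := q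
    induction q using QuotientGroup.induction_on with
    | H h =>
    change ((Matrix.GeneralLinearGroup.map (n := Fin 2) (Rat.castHom ℚ_[p]) h : GL (Fin 2) ℚ_[p]) :
      GL (Fin 2) ℚ_[p] ⧸ integralUpToScalars (PadicInt.Coe.ringHom (p := p))) ∈
        cosets (PadicInt.Coe.ringHom (p := p)) ((f.map (Int.castRingHom ℤ_[p])).map PadicInt.Coe.ringHom)
    rw [coe_mem_cosets_iff, ← map_ratCast_map_intCast]
    exact inv_map_smul_mem_integralForms ((coe_mem_cosets_iff _ _ h).mp hq)⟩

/-- `localize` on a representative: the coset of `h` goes to the coset of `(h)_p`. [folklore] -/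
theorem localize_mk_val (f : BinaryQuartic ℤ) (h : GL (Fin 2) ℚ)
    (hh : (h : GL (Fin 2) ℚ ⧸ integralUpToScalars (Int.castRingHom ℚ)) ∈
      cosets (Int.castRingHom ℚ) (f.map (Int.castRingHom ℚ))) (p : ℕ) [hp : Fact p.Prime] :
    (localize f ⟨h, hh⟩ ⟨p, hp.out⟩).1 =
      ((Matrix.GeneralLinearGroup.map (n := Fin 2) (Rat.castHom ℚ_[p]) h : GL (Fin 2) ℚ_[p]) :
        GL (Fin 2) ℚ_[p] ⧸ integralUpToScalars (PadicInt.Coe.ringHom (p := p))) := rfl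

/-- **Injectivity of `C(f) → ∏_p C_p(f)`.** [cite: BhargavaShankarAnnals2015, Prop. 3.6, proof (published numbering)] -/
theorem localize_injective (f : BinaryQuartic ℤ) : Function.Injective (localize f) := by
  rintro ⟨q, hq⟩ ⟨q', hq'⟩ hqq
  induction q using QuotientGroup.induction_on with
  | H h =>
  induction q' using QuotientGroup.induction_on with
  | H h' =>
  apply Subtype.ext
  refine coe_eq_coe_of_forall fun p hp ↦ ?_
  have := congrArg Subtype.val (congrFun hqq ⟨p, hp.out⟩)
  exact this

/-- The image of a global coset is trivial at almost all `p`. [folklore] -/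
theorem finite_setOf_localize_ne_base (f : BinaryQuartic ℤ)
    (q : cosets (Int.castRingHom ℚ) (f.map (Int.castRingHom ℚ))) :
    {p : Nat.Primes | localize f q p ≠ LocalCosets.base f p}.Finite := by
  obtain ⟨q, hq⟩ := q
  induction q using QuotientGroup.induction_on with
  | H h =>
  obtain ⟨T, hT⟩ := exists_finset_forall_coe_map_eq_one h
  refine ((T.finite_toSet.preimage Subtype.val_injective.injOn)).subset fun p hp ↦ ?_
  by_contra hpT
  apply hp
  haveI : Fact (p : ℕ).Prime := ⟨p.2⟩
  exact Subtype.ext (hT p hpT)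

/-- **Surjectivity onto the restricted product**: every family of local cosets, trivial for almost
all `p`, is the localisation of a global coset. [cite: BhargavaShankarAnnals2015, Prop. 3.6, proof (published numbering)] -/
theorem exists_localize_eq (f : BinaryQuartic ℤ) (c : ∀ p : Nat.Primes, LocalCosets f p)
    (hc : {p : Nat.Primes | c p ≠ LocalCosets.base f p}.Finite) : ∃ q, localize f q = c := by
  -- local representatives, `= 1` where the coset is trivial
  let loc : ∀ (p : ℕ) [Fact p.Prime], GL (Fin 2) ℚ_[p] := fun p hp ↦
    if c ⟨p, hp.out⟩ = LocalCosets.base f ⟨p, hp.out⟩ then 1 else Quotient.out (c ⟨p, hp.out⟩).1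
  have hloc_coe : ∀ (p : ℕ) [hp : Fact p.Prime],
      ((loc p : GL (Fin 2) ℚ_[p]) : GL (Fin 2) ℚ_[p] ⧸ integralUpToScalars (PadicInt.Coe.ringHom (p := p))) =
        (c ⟨p, hp.out⟩).1 := fun p hp ↦ by
    by_cases h1 : c ⟨p, hp.out⟩ = LocalCosets.base f ⟨p, hp.out⟩
    · simp only [loc, if_pos h1, h1]
      rfl
    · simp only [loc, if_neg h1]
      exact Quotient.out_eq _
  have hloc : ∀ (p : ℕ) [Fact p.Prime], (loc p)⁻¹ • (f.map (Int.castRingHom ℚ)).map (Rat.castHom ℚ_[p]) ∈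
      integralForms (PadicInt.Coe.ringHom (p := p)) := fun p hp ↦ by
    rw [← coe_mem_cosets_iff, hloc_coe, map_ratCast_map_intCast]
    exact (c ⟨p, hp.out⟩).2
  set T : Finset ℕ := hc.toFinset.image (fun p : Nat.Primes ↦ (p : ℕ)) with hT
  have hout : ∀ (p : ℕ) [Fact p.Prime], p ∉ T → loc p = 1 := fun p hp hpT ↦ by
    have h1 : c ⟨p, hp.out⟩ = LocalCosets.base f ⟨p, hp.out⟩ := by
      by_contra hne
      exact hpT (Finset.mem_image.mpr ⟨⟨p, hp.out⟩, hc.mem_toFinset.mpr hne, rfl⟩)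
    simp only [loc, if_pos h1]
  obtain ⟨h, hh, hhloc⟩ := exists_global_of_local (f.map (Int.castRingHom ℚ)) T loc hloc hout
  refine ⟨⟨h, (coe_mem_cosets_iff _ _ h).mpr hh⟩, funext fun p ↦ Subtype.ext ?_⟩
  obtain ⟨p, hp⟩ := p
  haveI : Fact p.Prime := ⟨hp⟩
  rw [localize_mk_val, hhloc p, hloc_coe]

/-- For `Δ(f) ≠ 0`, `C_p(f)` is finite, of size `localWeightAt p f = m_p(f)`. [folklore] -/
theorem finite_localCosets (f : BinaryQuartic ℤ) (hΔ : f.disc ≠ 0) (p : Nat.Primes) :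
    Finite (LocalCosets f p) ∧ Nat.card (LocalCosets f p) = localWeightAt p f := by
  haveI : Fact (p : ℕ).Prime := ⟨p.2⟩
  have hΔp : (f.map (Int.castRingHom ℤ_[p])).disc ≠ 0 := by
    rw [disc_map]; exact (map_ne_zero_iff (Int.castRingHom ℤ_[p]) Int.cast_injective).mpr hΔ
  have hfin := cosets_padic_finite_int (p := p) f hΔ
  refine ⟨hfin.to_subtype, ?_⟩
  rw [localWeightAt_of_prime, localWeight_eq_ncard_cosets _ hΔp, ← Nat.card_coe_set_eq]

/-- If `m_p(f) = 1` then `C_p(f)` is the single trivial coset. [folklore] -/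
theorem eq_base_of_localWeightAt_eq_one (f : BinaryQuartic ℤ) (hΔ : f.disc ≠ 0) (p : Nat.Primes)
    (h1 : localWeightAt p f = 1) (x : LocalCosets f p) : x = LocalCosets.base f p := by
  obtain ⟨hfin, hcard⟩ := finite_localCosets f hΔ p
  rw [h1] at hcard
  haveI : Subsingleton (LocalCosets f p) := (Nat.card_eq_one_iff_unique.mp hcard).1
  exact Subsingleton.elim _ _

/-- **The bijection `C(f) ≃ ∏_{p : m_p(f) ≠ 1} C_p(f)` counted**: for `Δ(f) ≠ 0` the global coset set
`C(f)` is finite and `#C(f) = ∏_p m_p(f)`. [cite: BhargavaShankarAnnals2015, Prop. 3.6, proof (published numbering)] -/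
theorem cosets_int_finite_and_ncard_eq (f : BinaryQuartic ℤ) (hΔ : f.disc ≠ 0) :
    (cosets (Int.castRingHom ℚ) (f.map (Int.castRingHom ℚ))).Finite ∧
      (cosets (Int.castRingHom ℚ) (f.map (Int.castRingHom ℚ))).ncard = ∏ᶠ p, localWeightAt p f := by
  have hfinS := finite_setOf_localWeightAt_ne_one f hΔ
  set T : Finset ℕ := hfinS.toFinset with hT
  have hTprime : ∀ p ∈ T, p.Prime := fun p hp ↦ by
    by_contra hnp
    exact (hfinS.mem_toFinset.mp hp) (localWeightAt_of_not_prime hnp f)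
  have hbase : ∀ p : Nat.Primes, (p : ℕ) ∉ T → ∀ x : LocalCosets f p, x = LocalCosets.base f p :=
    fun p hp ↦ eq_base_of_localWeightAt_eq_one f hΔ p (by
      by_contra hne; exact hp (hfinS.mem_toFinset.mpr hne))
  -- the fibres over `T`
  haveI hXfin : ∀ p : T, Finite (LocalCosets f ⟨p, hTprime p p.2⟩) := fun p ↦
    (finite_localCosets f hΔ ⟨p, hTprime p p.2⟩).1
  -- restriction to `T` of the localisation map, and its bijectivity
  let toF : cosets (Int.castRingHom ℚ) (f.map (Int.castRingHom ℚ)) → ∀ p : T, LocalCosets f ⟨p, hTprime p p.2⟩ :=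
    fun q p ↦ localize f q ⟨p, hTprime p p.2⟩
  have htoF_inj : Function.Injective toF := by
    intro q q' hqq
    apply localize_injective f
    funext p
    by_cases hp : (p : ℕ) ∈ T
    · exact congrFun hqq ⟨p, hp⟩
    · rw [hbase p hp (localize f q p), hbase p hp (localize f q' p)]
  have htoF_surj : Function.Surjective toF := by
    intro c
    -- extend `c` by trivial cosets
    let c' : ∀ p : Nat.Primes, LocalCosets f p := fun p ↦
      if hp : (p : ℕ) ∈ T then c ⟨p, hp⟩ else LocalCosets.base f p
    have hc' : {p : Nat.Primes | c' p ≠ LocalCosets.base f p}.Finite := by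
      refine (T.finite_toSet.preimage Subtype.val_injective.injOn).subset fun p hp ↦ ?_
      by_contra hpT
      apply hp
      simp only [Set.mem_preimage, Finset.mem_coe] at hpT
      simp only [c', dif_neg hpT]
    obtain ⟨q, hq⟩ := exists_localize_eq f c' hc'
    refine ⟨q, funext fun p ↦ ?_⟩
    have h1 : c' ⟨p, hTprime p p.2⟩ = c p := by
      simp only [c', dif_pos p.2]
    rw [← h1, ← hq]
  let e : cosets (Int.castRingHom ℚ) (f.map (Int.castRingHom ℚ)) ≃ ∀ p : T, LocalCosets f ⟨p, hTprime p p.2⟩ :=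
    Equiv.ofBijective toF ⟨htoF_inj, htoF_surj⟩
  -- counting
  haveI : Finite (cosets (Int.castRingHom ℚ) (f.map (Int.castRingHom ℚ))) := Finite.of_equiv _ e.symm
  refine ⟨Set.toFinite _, ?_⟩
  rw [← Nat.card_coe_set_eq, Nat.card_congr e, Nat.card_pi,
    finprod_eq_prod_of_mulSupport_subset _ (s := T) (fun p hp ↦ by exact hfinS.mem_toFinset.mpr hp),
    ← Finset.prod_coe_sort T]
  refine Finset.prod_congr rfl fun p _ ↦ ?_
  exact (finite_localCosets f hΔ ⟨p, hTprime p p.2⟩).2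

/-- **Bhargava–Shankar, Prop. 3.6.** For an integral binary quartic form `f` with `Δ(f) ≠ 0`,
`m(f) = ∏_p m_p(f)` (the product being finite: `m_p(f) = 1` for all `p ≥ 5` with `p² ∤ Δ(f)`).
[cite: BhargavaShankarAnnals2015, Prop. 3.6 (published numbering)] -/
theorem globalWeight_eq_finprod_localWeightAt (f : BinaryQuartic ℤ) (hΔ : f.disc ≠ 0) :
    globalWeight f = ∏ᶠ p, localWeightAt p f := by
  obtain ⟨hfin, hcard⟩ := cosets_int_finite_and_ncard_eq f hΔ
  rw [globalWeight, weight_eq_ncard_cosets _ _ hfin, hcard]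

/-- `m(f) = #C(f)` (the number of cosets `PGL₂(ℤ)g`, `g ∈ PGL₂(ℚ)`, with `g · f ∈ V_ℤ`) for
`Δ(f) ≠ 0`. [cite: BhargavaShankarAnnals2015, §3.2 and Prop. 3.6 (published numbering)] -/
theorem globalWeight_eq_ncard_cosets (f : BinaryQuartic ℤ) (hΔ : f.disc ≠ 0) :
    globalWeight f = (cosets (Int.castRingHom ℚ) (f.map (Int.castRingHom ℚ))).ncard :=
  weight_eq_ncard_cosets _ _ (cosets_int_finite_and_ncard_eq f hΔ).1

/-- `m(f) ≥ 1` for `Δ(f) ≠ 0`. [folklore] -/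
theorem one_le_globalWeight_of_disc_ne_zero (f : BinaryQuartic ℤ) (hΔ : f.disc ≠ 0) : 1 ≤ globalWeight f :=
  one_le_globalWeight f (cosets_int_finite_and_ncard_eq f hΔ).1

/-- `m(f)` is the number `n(f)` of `PGL₂(ℤ)`-orbits in the `PGL₂(ℚ)`-class of `f` in `V_ℤ` exactly
when every integral form in the class has `Aut_ℚ = Aut_ℤ` (for instance trivial `Aut_ℚ`), for
`Δ(f) ≠ 0` ("`m(f) = n(f)` unless some `f' ∈ B(f)` has a nontrivial stabilizer", §3.2).
[cite: BhargavaShankarAnnals2015, §3.2 (published numbering)] -/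
theorem globalWeight_eq_ncard_intClassOrbits_iff (f : BinaryQuartic ℤ) (hΔ : f.disc ≠ 0) :
    globalWeight f = (intClassOrbits (Int.castRingHom ℚ) (f.map (Int.castRingHom ℚ))).ncard ↔
      ∀ f' ∈ orbit (GL (Fin 2) ℚ) (f.map (Int.castRingHom ℚ)) ∩ integralForms (Int.castRingHom ℚ),
        stabilizer (GL (Fin 2) ℚ) f' ≤ integralUpToScalars (Int.castRingHom ℚ) :=
  weight_eq_ncard_intClassOrbits_iff _ _ (cosets_int_finite_and_ncard_eq f hΔ).1

end BinaryQuartic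

end Literature.NumberTheory.EllipticCurves

end
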